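import Summits.BirchSwinnertonDyer.BirchSwinnertonDyer.Theorems.TameQuarticManinParityTprimeHeegnerUpperOfManinUnitMonoCarrier
import Summits.BirchSwinnertonDyer.BirchSwinnertonDyer.Theorems.TameQuarticManinParityTprimeHeegnerUpperOfManinUnitSigmaCarrierBlind
import Summits.BirchSwinnertonDyer.BirchSwinnertonDyer.Theorems.TameQuarticManinParityTprimeHeegnerUpperOfManinUnitSigmaMinf
import HarnessLib

/-!
# Crux X₄ `TprimeHeegnerUpperOfManinUnit` (stmt-BirchSwinnertonDyer-23738; TQMP r4 / TQS r303), line `rows_of_manin_unit` v2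
# (3c59fc8b80b3), research stub Σ `stub_sigmaIrreducibleOptimalRows`: Σ ON ALL MONO-CARRIER (t′) ROWS — the unique Tamagawa-`3`
# carrier MULTIPLICATIVE (census (M1)) OR ADDITIVE of Kodaira type `IV`/`IV*` (census (M2), serve-list brief v2 «S2-add») — from
# crux 20165's registered reading S2′ + three named Literature facts; the typed upper half there ⟸ PUB + the same + L₀

HONEST FRAMING. Theorems only; helper file (`--supports stmt-BirchSwinnertonDyer-23738 --as helper`, leafhand `leafhand-bsd-tamequarticmaninpa-5`
g0, 2026-08-31); no definition, no named fact, no `sorry`; CONDITIONAL on every displayed input; nothing booked, no stub closed BY NAME, no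
item closed, BSD proved for no curve. Sequel of `…SigmaCarrierBlind` (this seat: the reading S2♭ at ANY carrier `q ∣ N_E` ⟸ S2′ + {Gross
3.7 (2), Poitou–Tate, GZ86 III (3.1) image-free}) and of `…MonoCarrier` (p824349: mono-MULTIPLICATIVE-carrier rows ⟸ RHP 27492 BY NAME).
* §1 `pDiv_of_dvd_level_of_heegnerFrame_of_prop52IrredP_of_namedFacts` — S2♭ on a Heegner frame `(Dt, H.β, ι, P)` (odd `p ∣ N_E`, `E[p]`
  irreducible): `Koly.PDiv d p s` for `s ≤ ord_p c_q(E)` at ANY prime `q ∣ N_E` (conductor-`1` datum with bottom point `P`: tree theorem).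
* §1b `natCast_tamagawaExponent_le_minf_of_dvd_level_of_prop52IrredP_of_namedFacts` — **Jetchev's Thm. 1.4 at an additive `p`, `E[p]` irreducible,
  McCallum currency**: `(ord_p c_q(E) : ℕ∞) ≤ Koly.Minf` for EVERY prime `q ∣ N_E` (`M_∞ ≥ m_max`; what the reading pays on ≥ 2-carrier rows).
* §2 `sigmaIrreducibleOptimalRows_monoCarrier_of_prop52IrredP_of_namedFacts` — **Σ's binders VERBATIM + ONE row clause** «some prime
  `q ∣ N_E` has `ord₃ ∏_ℓ c_ℓ(E) ≤ ord₃ c_q(E)`» (ANY reduction type at `q`) ⟹ Σ's conclusion, from S2′ + the three facts ALONE (no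
  PUB, no `r_an`, no Manin, no twisted `L`: `d_K ≠ −3` because `3 ∣ N_E` splits, `d_K ≠ −4` because `d_K` is odd).
* §3 `tprime_upper_three_of_irreducible_carrier_of_prop52IrredP_of_namedFacts_of_lowerRankZero` — the typed upper half `MissingUpperBoundAt W 3`
  on such a row with a Manin-clean datum ⟸ PUB + S2′ + three facts + L₀ (p823764's Σ-at-datum socket); §4 `irreducibleRows_monoCarrier_of_pub_…`
  — in the binders of the irreducible-row stubs (r₁/r₂ of v1, Σ-side of v2): ALL mono-carrier rows ⟸ PUB + S2′ + three facts + KT 19981 BY NAME.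

ACCOUNTING for Σ after this file: (M1) ∪ (M2) ∪ (Tamagawa-`3`-free) = «∃ `q ∣ N_E` with `ord₃ ∏ c_ℓ ≤ ord₃ c_q`» is ONE reading-grade
case ⟸ {`Sig.stub_prop52IrredP` of 20165 (McCallum Prop. 5.2 irreducible, potss k8t-c4's lane), Gross 3.7 (2), Poitou–Tate, GZ86 III (3.1)};
Σ is GENUINELY OPEN only on the rows with ≥ 2 Tamagawa-`3` carriers ((M3): `M_∞ ≥ ord₃ ∏ c_ℓ`, the refined Kolyvagin `≥`-half at the
additive (t′) prime `3`, p826193), where the reading pays `M_∞ ≥ m_max` (§1b).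
References: [cite: Jetchev2008, Thm. 1.4 and Cor. 1.5 (p. 812), Conj. 1.3, Thm. 5.2 (p. 821), Rem. 6.2] [cite: McCallumLMS1991, §5 Prop. 5.2 (p. 304)]
[cite: GrossLMS1991, Prop. 3.7 (2), §6 p. 245] [cite: GrossZagier1986, III (3.1), Thm. I.(6.3), (7.3)] [cite: MatarNekovar2019, Thm. 0.7 (p. 456), §0.11 (p. 457)]
[cite: FriedbergHoffstein1995, Thm. B] [cite: Darmon2004, Prop. 3.6, Thm. 3.9] [cite: Miller2011LMS, Def. 1.1] [cite: Kato2004Asterisque, Thm. 17.4].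
presearch (D-0021): `lean search 'monoCarrier|of_dvd_level'` → p824349 (multiplicative carrier only), this seat's `…SigmaCarrierBlind`;
[corpus:arxiv-math_0703431 p. 3 Thm. 1.4, §6 Thm. 6.3]: `m_∞ ≥ m_max = max_{q ∣ N} ord_p c_q` over the primes `q ∣ N` of ANY reduction type
(Hypothesis (∗) = `p ∤ N`, `ρ̄` onto); galaxy «divisibility of Heegner|Tamagawa numbers and|additive reduction Kolyvagin» + vsearch → none new.
-/

-- D-0017: single-problem summit, so `Summit.BirchSwinnertonDyer.BirchSwinnertonDyer.…` repeats a namespace BY DESIGN.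
set_option linter.dupNamespace false
set_option autoImplicit false
noncomputable section

open scoped Classical NumberField

open WeierstrassCurve IsDedekindDomain NumberField Literature Literature.NumberTheory.EllipticCurves
  Literature.NumberTheory.EllipticCurves.ModularForms
  Literature.NumberTheory.EllipticCurves.Rank1Residual
  Literature.NumberTheory.EllipticCurves.Rank1Residual.Typed
  Literature.NumberTheory.GaloisCohomology
  Summit.BirchSwinnertonDyer.Rank1Residual
  Summit.BirchSwinnertonDyer.Rank1Residual.Additive
  Summit.BirchSwinnertonDyer.Rank1Residual.X11b
  Summit.BirchSwinnertonDyer.Rank1Residual.X11b.Three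
  Summit.BirchSwinnertonDyer.BirchSwinnertonDyer.Theses
  Summit.BirchSwinnertonDyer.BirchSwinnertonDyer.Theorems

namespace Summit.BirchSwinnertonDyer.BirchSwinnertonDyer.Theorems.TprimeHeegnerUpperOfManinUnit

/-! ## §1 S2♭ on a Heegner frame: `p^s ∣ P_n` to depth `ord_p c_q(E)` at ANY carrier `q ∣ N_E` -/

/-- **S2♭ ON A HEEGNER FRAME `(Dt, H.β, ι, P)`.** For `W/ℚ` globally minimal non-CM, `K` imaginary quadratic with `d_K ∉ {−3, −4}`
and the Heegner hypothesis for `N_E`, `p` odd with `E[p]` irreducible and `p ∣ N_E`, a parametrisation datum `Dt` at level `N_E`, a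
Heegner datum `H`, `ι : K → ℂ`, the `K`-rational Heegner point `P` of `Dt` (non-torsion), ANY prime `q ∣ N_E` and `s ≤ ord_p c_q(E)`:
`p^s ∣ P_n` in `E(K[n])` (`Koly.PDiv d p s`) for every Kolyvagin–Heegner datum `d` of squarefree conductor `n` whose primes are
Kolyvagin of index `≥ s`. DISPLAYED INPUTS: crux 20165's registered reading S2′ (`h52I`, McCallum Prop. 5.2 irreducible, VERBATIM)
and the NAMED Literature facts `h37` (Gross 1991 Prop. 3.7 (2)), `hPT` (Poitou–Tate, ∀ K), `hF1` ([GZ86 III (3.1)] image-free). Proof: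
the conductor-`1` Kolyvagin–Heegner datum with bottom point `P` is a tree theorem (Darmon 3.6 / Shimura reciprocity), then
`JetchevIrreducibleCarrierBlind.divisibility_of_dvd_level_of_prop52IrredP_of_namedFacts`. CONDITIONAL; nothing asserted.
[cite: Jetchev2008, Thm. 1.4 (ii) (p. 812), Thm. 5.2, Rem. 6.2] [cite: McCallumLMS1991, §5 Prop. 5.2 (p. 304)]
[cite: GrossLMS1991, Prop. 3.7 (2), §6 p. 245] [cite: Darmon2004, Prop. 3.6 and Thm. 3.9] -/
theorem pDiv_of_dvd_level_of_heegnerFrame_of_prop52IrredP_of_namedFacts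
    (h52I : ∀ (W : WeierstrassCurve ℚ) [W.IsElliptic] [W.IsGloballyMinimal] [NeZero (W.conductorNorm ℤ)],
        ¬ W.HasCM →
        ∀ (K : Type) [Field K] [NumberField K], IsImaginaryQuadratic K →
        NumberField.discr K ≠ -3 → NumberField.discr K ≠ -4 →
        SatisfiesHeegnerHypothesis (W.conductorNorm ℤ) K →
        ∀ (p : ℕ) [Fact p.Prime], p ≠ 2 → W.HasIrreducibleModPGaloisRep p → (p : ℤ) ∣ W.conductorNorm ℤ →
        ∀ (Dt : ModularParametrizationData W (W.conductorNorm ℤ)) (β : ℤ) (ι : K →+* ℂ)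
          (d₁ : KolyvaginHeegnerData Dt β ι 1), ¬ IsOfFinAddOrder d₁.derivedPoint →
        ∀ (r : ℕ), 0 < r →
        ∀ (Mr : ℕ),
          IsLeast {u : ℕ | ∃ (n : ℕ) (d : KolyvaginHeegnerData Dt β ι n), Squarefree n ∧
              n.primeFactors.card = r ∧
              (∀ ℓ ∈ n.primeFactors, Zhang2014.IsKolyvaginPrime (W.conductorNorm ℤ) W K p ℓ ∧
                u + 1 ≤ Zhang2014.kolyvaginIndex W p ℓ) ∧
              (∃ Q : (W.baseChange (ringClassField K ι n)).toAffine.Point,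
                ((p ^ u : ℕ) : ℤ) • Q = d.derivedPoint) ∧
              ¬ ∃ Q : (W.baseChange (ringClassField K ι n)).toAffine.Point,
                ((p ^ (u + 1) : ℕ) : ℤ) • Q = d.derivedPoint} Mr →
        ∀ (M : ℕ), Mr < M →
          ∃ (n : ℕ) (d : KolyvaginHeegnerData Dt β ι n), Squarefree n ∧ n.primeFactors.card = r ∧
            (∀ ℓ ∈ n.primeFactors, Zhang2014.IsKolyvaginPrime (W.conductorNorm ℤ) W K p ℓ ∧
              M ≤ Zhang2014.kolyvaginIndex W p ℓ) ∧
            addOrderOf (d.kolyvaginClass (Fact.out : p.Prime) M) = p ^ (M - Mr) ∧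
            (∃ Q : (W.baseChange (ringClassField K ι n)).toAffine.Point,
              ((p ^ Mr : ℕ) : ℤ) • Q = d.derivedPoint) ∧
            ¬ ∃ Q : (W.baseChange (ringClassField K ι n)).toAffine.Point,
              ((p ^ (Mr + 1) : ℕ) : ℤ) • Q = d.derivedPoint)
    (h37 : GrossLMS1991.prop37_2_frobeniusCongruence)
    (hPT : ∀ (K : Type) [Field K] [NumberField K], poitouTate_selmerStructure_duality_conj K)
    (hF1 : Gross1991_heegnerPoint_sub_ratTorsion_mem_E0_imageFree)
    (W : WeierstrassCurve ℚ) [W.IsElliptic] [W.IsGloballyMinimal] [NeZero (W.conductorNorm ℤ)]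
    (hCM : ¬ W.HasCM) (K : Type) [Field K] [NumberField K] (hK : IsImaginaryQuadratic K)
    (h3 : NumberField.discr K ≠ -3) (h4 : NumberField.discr K ≠ -4)
    (hHN : SatisfiesHeegnerHypothesis (W.conductorNorm ℤ) K)
    (p : ℕ) [Fact p.Prime] (hp2 : p ≠ 2) (hirr : W.HasIrreducibleModPGaloisRep p) (hpN : p ∣ W.conductorNorm ℤ)
    (Dt : ModularParametrizationData W (W.conductorNorm ℤ))
    (H : HeegnerDatum (W.conductorNorm ℤ) (NumberField.discr K)) (ι : K →+* ℂ) (P : (W.baseChange K).toAffine.Point)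
    (hP : WeierstrassCurve.Affine.Point.map ι.toRatAlgHom P = heegnerPointComplex Dt H) (hnt : ¬ IsOfFinAddOrder P)
    (q : ℕ) [Fact q.Prime] (hqN : q ∣ W.conductorNorm ℤ)
    (s : ℕ) (hs : s ≤ padicValNat p ((W.baseChange ℚ_[q]).localTamagawaNumber ℤ_[q]))
    (n : ℕ) (d : KolyvaginHeegnerData Dt H.β ι n) (hn : Squarefree n)
    (hℓ : ∀ ℓ ∈ n.primeFactors, Zhang2014.IsKolyvaginPrime (W.conductorNorm ℤ) W K p ℓ ∧
      s ≤ Zhang2014.kolyvaginIndex W p ℓ) :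
    Koly.PDiv d p s := by
  -- the conductor-`1` Kolyvagin–Heegner datum on the frame, with bottom point `P` (Darmon 3.6 / Shimura, proved)
  obtain ⟨d₁⟩ := exists_kolyvaginHeegnerData_one
    (phi_heegnerTau_mem_singularModuliField_holds (W.conductorNorm ℤ) W K) hK Dt H.β ι H.dvd_sq_sub
  have hPd : d₁.toGeomPoints d₁.derivedPoint = toGeomPoints (W.baseChange K) P :=
    X11b.KolyvaginBottom.toGeomPoints_derivedPoint_one_eq
      (heegnerPointOfConductor_one_galoisConj_holds (W.conductorNorm ℤ) W K) hK hHN hP d₁ rfl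
  have hy₁ : ¬ IsOfFinAddOrder d₁.derivedPoint := by
    intro hfin
    apply hnt
    have h1 : IsOfFinAddOrder (d₁.toGeomPoints d₁.derivedPoint) := d₁.toGeomPoints.isOfFinAddOrder hfin
    rw [hPd] at h1
    exact (toGeomPoints_injective (W.baseChange K)).isOfFinAddOrder_iff.mp h1
  exact JetchevIrreducibleCarrierBlind.divisibility_of_dvd_level_of_prop52IrredP_of_namedFacts h52I h37 hPT hF1 W hCM K
    hK h3 h4 hHN p hp2 hirr hpN Dt H.β ι d₁ hy₁ q hqN s hs n d hn hℓ

/-- **JETCHEV'S THEOREM 1.4 IN THE IRREDUCIBLE ADDITIVE-`p` READING, McCALLUM CURRENCY, AT EVERY CARRIER: `ord_p c_q(E) ≤ M_∞`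
for every prime `q ∣ N_E`, i.e. `M_∞ ≥ m_max = max_{q ∣ N_E} ord_p c_q(E)`** ([J] Thm. 1.4 has Hypothesis (∗) = `p ∤ N`, `ρ̄` onto; here `p ∣ N_E`,
`E[p]` irreducible, `d_K ∉ {−3, −4}`), on a Heegner frame `(Dt, H.β, ι, P)` with `P` non-torsion, `Koly.Minf` = the tree's `M_∞` (p826193's
dictionary `globalDivisibility_iff_natCast_le_minf`). DISPLAYED INPUTS: S2′ (`h52I`) + the three named facts. On a row with ≥ 2 Tamagawa-`p`
carriers this is what the carrier-blind reading pays (`m_max`), short of Σ's `ord_p ∏ c_ℓ` (Jetchev's Conj. 1.3). CONDITIONAL; nothing asserted.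
[cite: Jetchev2008, Thm. 1.4 (p. 812), Conj. 1.3, §6 Thm. 6.3] [cite: McCallumLMS1991, §5 (p. 303), Prop. 5.2 (p. 304)] -/
theorem natCast_tamagawaExponent_le_minf_of_dvd_level_of_prop52IrredP_of_namedFacts
    (h52I : ∀ (W : WeierstrassCurve ℚ) [W.IsElliptic] [W.IsGloballyMinimal] [NeZero (W.conductorNorm ℤ)],
        ¬ W.HasCM →
        ∀ (K : Type) [Field K] [NumberField K], IsImaginaryQuadratic K →
        NumberField.discr K ≠ -3 → NumberField.discr K ≠ -4 →
        SatisfiesHeegnerHypothesis (W.conductorNorm ℤ) K →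
        ∀ (p : ℕ) [Fact p.Prime], p ≠ 2 → W.HasIrreducibleModPGaloisRep p → (p : ℤ) ∣ W.conductorNorm ℤ →
        ∀ (Dt : ModularParametrizationData W (W.conductorNorm ℤ)) (β : ℤ) (ι : K →+* ℂ)
          (d₁ : KolyvaginHeegnerData Dt β ι 1), ¬ IsOfFinAddOrder d₁.derivedPoint →
        ∀ (r : ℕ), 0 < r →
        ∀ (Mr : ℕ),
          IsLeast {u : ℕ | ∃ (n : ℕ) (d : KolyvaginHeegnerData Dt β ι n), Squarefree n ∧
              n.primeFactors.card = r ∧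
              (∀ ℓ ∈ n.primeFactors, Zhang2014.IsKolyvaginPrime (W.conductorNorm ℤ) W K p ℓ ∧
                u + 1 ≤ Zhang2014.kolyvaginIndex W p ℓ) ∧
              (∃ Q : (W.baseChange (ringClassField K ι n)).toAffine.Point,
                ((p ^ u : ℕ) : ℤ) • Q = d.derivedPoint) ∧
              ¬ ∃ Q : (W.baseChange (ringClassField K ι n)).toAffine.Point,
                ((p ^ (u + 1) : ℕ) : ℤ) • Q = d.derivedPoint} Mr →
        ∀ (M : ℕ), Mr < M →
          ∃ (n : ℕ) (d : KolyvaginHeegnerData Dt β ι n), Squarefree n ∧ n.primeFactors.card = r ∧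
            (∀ ℓ ∈ n.primeFactors, Zhang2014.IsKolyvaginPrime (W.conductorNorm ℤ) W K p ℓ ∧
              M ≤ Zhang2014.kolyvaginIndex W p ℓ) ∧
            addOrderOf (d.kolyvaginClass (Fact.out : p.Prime) M) = p ^ (M - Mr) ∧
            (∃ Q : (W.baseChange (ringClassField K ι n)).toAffine.Point,
              ((p ^ Mr : ℕ) : ℤ) • Q = d.derivedPoint) ∧
            ¬ ∃ Q : (W.baseChange (ringClassField K ι n)).toAffine.Point,
              ((p ^ (Mr + 1) : ℕ) : ℤ) • Q = d.derivedPoint)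
    (h37 : GrossLMS1991.prop37_2_frobeniusCongruence)
    (hPT : ∀ (K : Type) [Field K] [NumberField K], poitouTate_selmerStructure_duality_conj K)
    (hF1 : Gross1991_heegnerPoint_sub_ratTorsion_mem_E0_imageFree)
    (W : WeierstrassCurve ℚ) [W.IsElliptic] [W.IsGloballyMinimal] [NeZero (W.conductorNorm ℤ)]
    (hCM : ¬ W.HasCM) (K : Type) [Field K] [NumberField K] (hK : IsImaginaryQuadratic K)
    (h3 : NumberField.discr K ≠ -3) (h4 : NumberField.discr K ≠ -4)
    (hHN : SatisfiesHeegnerHypothesis (W.conductorNorm ℤ) K)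
    (p : ℕ) [Fact p.Prime] (hp2 : p ≠ 2) (hirr : W.HasIrreducibleModPGaloisRep p) (hpN : p ∣ W.conductorNorm ℤ)
    (Dt : ModularParametrizationData W (W.conductorNorm ℤ))
    (H : HeegnerDatum (W.conductorNorm ℤ) (NumberField.discr K)) (ι : K →+* ℂ) (P : (W.baseChange K).toAffine.Point)
    (hP : WeierstrassCurve.Affine.Point.map ι.toRatAlgHom P = heegnerPointComplex Dt H) (hnt : ¬ IsOfFinAddOrder P)
    (q : ℕ) [Fact q.Prime] (hqN : q ∣ W.conductorNorm ℤ) :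
    (padicValNat p ((W.baseChange ℚ_[q]).localTamagawaNumber ℤ_[q]) : ℕ∞) ≤ Koly.Minf Dt H.β ι p :=
  (globalDivisibility_iff_natCast_le_minf p _).mp fun s hs n d hn hℓ ↦
    pDiv_of_dvd_level_of_heegnerFrame_of_prop52IrredP_of_namedFacts h52I h37 hPT hF1 W hCM K hK h3 h4 hHN p hp2 hirr hpN Dt
      H ι P hP hnt q hqN s hs n d hn hℓ

/-! ## §2 Σ (`stub_sigmaIrreducibleOptimalRows`) on ALL mono-carrier (t′) rows — multiplicative OR additive carrier -/

/-- **Σ ON THE MONO-CARRIER (t′) ROWS ⟸ S2′ + three named facts.** The registered research stub Σ = `stub_sigmaIrreducibleOptimalRows`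
of line `rows_of_manin_unit` v2 (crux 23738), binders VERBATIM, with ONE row clause inserted after `Odd (d_K)`: (ROW) some prime
`q ∣ N_E` carries the whole `3`-part of the Tamagawa product, `ord₃ ∏_ℓ c_ℓ(E) ≤ ord₃ c_q(E)` — `q` of ANY reduction type
(multiplicative `q ∥ N_E`, or an additive `q ≠ 3` of Kodaira type `IV`/`IV*`; the Tamagawa-`3`-free rows are the sub-case `q = 3`,
`ord₃ ∏ c_ℓ = 0`). On these rows Σ follows from crux 20165's registered reading S2′ (`h52I`, VERBATIM) and the three named Literature
facts, with NO analytic-rank, Manin, (t′) or twisted-`L` input used (`d_K ≠ −3` because `3 ∣ N_E` splits in `K`; `d_K ≠ −4` because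
`d_K` is odd). Hence the census items (M1) (mono-multiplicative, formerly RHP 27492 BY NAME) and (M2) (mono-additive `IV`/`IV*`,
formerly «not covered as typed») are ONE reading-grade case; Σ stays open exactly on the rows with ≥ 2 Tamagawa-`3` carriers
(refined Kolyvagin `M_∞ ≥ ord₃ ∏ c_ℓ`, p826193). CONDITIONAL; closes nothing by name.
[cite: Jetchev2008, Thm. 1.4 (p. 812), Conj. 1.3] [cite: McCallumLMS1991, §5 Prop. 5.2 (p. 304)] [cite: GrossLMS1991, Prop. 3.7 (2), §6 p. 245] -/
theorem sigmaIrreducibleOptimalRows_monoCarrier_of_prop52IrredP_of_namedFacts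
    (h52I : ∀ (W : WeierstrassCurve ℚ) [W.IsElliptic] [W.IsGloballyMinimal] [NeZero (W.conductorNorm ℤ)],
        ¬ W.HasCM →
        ∀ (K : Type) [Field K] [NumberField K], IsImaginaryQuadratic K →
        NumberField.discr K ≠ -3 → NumberField.discr K ≠ -4 →
        SatisfiesHeegnerHypothesis (W.conductorNorm ℤ) K →
        ∀ (p : ℕ) [Fact p.Prime], p ≠ 2 → W.HasIrreducibleModPGaloisRep p → (p : ℤ) ∣ W.conductorNorm ℤ →
        ∀ (Dt : ModularParametrizationData W (W.conductorNorm ℤ)) (β : ℤ) (ι : K →+* ℂ)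
          (d₁ : KolyvaginHeegnerData Dt β ι 1), ¬ IsOfFinAddOrder d₁.derivedPoint →
        ∀ (r : ℕ), 0 < r →
        ∀ (Mr : ℕ),
          IsLeast {u : ℕ | ∃ (n : ℕ) (d : KolyvaginHeegnerData Dt β ι n), Squarefree n ∧
              n.primeFactors.card = r ∧
              (∀ ℓ ∈ n.primeFactors, Zhang2014.IsKolyvaginPrime (W.conductorNorm ℤ) W K p ℓ ∧
                u + 1 ≤ Zhang2014.kolyvaginIndex W p ℓ) ∧
              (∃ Q : (W.baseChange (ringClassField K ι n)).toAffine.Point,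
                ((p ^ u : ℕ) : ℤ) • Q = d.derivedPoint) ∧
              ¬ ∃ Q : (W.baseChange (ringClassField K ι n)).toAffine.Point,
                ((p ^ (u + 1) : ℕ) : ℤ) • Q = d.derivedPoint} Mr →
        ∀ (M : ℕ), Mr < M →
          ∃ (n : ℕ) (d : KolyvaginHeegnerData Dt β ι n), Squarefree n ∧ n.primeFactors.card = r ∧
            (∀ ℓ ∈ n.primeFactors, Zhang2014.IsKolyvaginPrime (W.conductorNorm ℤ) W K p ℓ ∧
              M ≤ Zhang2014.kolyvaginIndex W p ℓ) ∧
            addOrderOf (d.kolyvaginClass (Fact.out : p.Prime) M) = p ^ (M - Mr) ∧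
            (∃ Q : (W.baseChange (ringClassField K ι n)).toAffine.Point,
              ((p ^ Mr : ℕ) : ℤ) • Q = d.derivedPoint) ∧
            ¬ ∃ Q : (W.baseChange (ringClassField K ι n)).toAffine.Point,
              ((p ^ (Mr + 1) : ℕ) : ℤ) • Q = d.derivedPoint)
    (h37 : GrossLMS1991.prop37_2_frobeniusCongruence)
    (hPT : ∀ (K : Type) [Field K] [NumberField K], poitouTate_selmerStructure_duality_conj K)
    (hF1 : Gross1991_heegnerPoint_sub_ratTorsion_mem_E0_imageFree) :
    ∀ (W : WeierstrassCurve ℚ) [W.IsElliptic] [W.IsGloballyMinimal] [NeZero (W.conductorNorm ℤ)]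
      (K : Type) [Field K] [NumberField K] (Dt : ModularParametrizationData W (W.conductorNorm ℤ))
      (H : HeegnerDatum (W.conductorNorm ℤ) (NumberField.discr K)) (ι : K →+* ℂ) (P : (W.baseChange K).toAffine.Point),
      ¬ W.HasCM → Addv W 3 → SubTprime W 3 → W.HasIrreducibleModPGaloisRep 3 → W.analyticRank = 1 →
      ¬ (3 : ℤ) ∣ Dt.c → IsImaginaryQuadratic K → SatisfiesHeegnerHypothesis (W.conductorNorm ℤ) K →
      (W.quadraticTwist (NumberField.discr K : ℚ)).entireLFunction 1 ≠ 0 →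
      WeierstrassCurve.Affine.Point.map ι.toRatAlgHom P = heegnerPointComplex Dt H → ¬ IsOfFinAddOrder P →
      Odd (NumberField.discr K) →
      (∃ (q : ℕ) (_ : Fact q.Prime), q ∣ W.conductorNorm ℤ ∧
        padicValNat 3 W.tamagawaProduct ≤ padicValNat 3 ((W.baseChange ℚ_[q]).localTamagawaNumber ℤ_[q])) →
      ∀ (s' : ℕ), s' ≤ padicValNat 3 W.tamagawaProduct →
      ∀ (n : ℕ) (d : KolyvaginHeegnerData Dt H.β ι n), Squarefree n →
      (∀ ℓ ∈ n.primeFactors, Zhang2014.IsKolyvaginPrime (W.conductorNorm ℤ) W K 3 ℓ ∧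
        s' ≤ Zhang2014.kolyvaginIndex W 3 ℓ) → Koly.PDiv d 3 s' := by
  intro W _ _ _ K _ _ Dt H ι P hCM hadd _ hirr _ _ hK hHN _ hP hnt hodd hrow s' hs' n d hn hℓ
  obtain ⟨q, hq, hqN, hmono⟩ := hrow
  have h3N : 3 ∣ W.conductorNorm ℤ :=
    (W.dvd_conductorNorm_iff_not_hasGoodReductionAtPrime 3).mpr (not_good_of_addv W 3 hadd)
  -- `d_K ∉ {-3, -4}`: `3 ∣ N_E` splits in `K`, `d_K` odd
  have h3 : NumberField.discr K ≠ -3 := by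
    intro h
    exact (X11b.Three.not_dvd_discr_and_not_dvd_torsionOrder_of_heegner hK hHN (by decide) h3N).1
      (h ▸ ⟨-1, by norm_num⟩)
  have h4 : NumberField.discr K ≠ -4 := by
    intro h
    rw [h] at hodd
    exact (Int.not_odd_iff_even.mpr ⟨-2, by norm_num⟩) hodd
  exact pDiv_of_dvd_level_of_heegnerFrame_of_prop52IrredP_of_namedFacts h52I h37 hPT hF1 W hCM K hK h3 h4 hHN 3 (by decide)
    hirr h3N Dt H ι P hP hnt q hqN s' (hs'.trans hmono) n d hn hℓ

/-! ## §3 The typed upper half on the mono-carrier (t′) rows with a Manin-clean datum ⟸ PUB + S2′ + three named facts + L₀ -/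

/-- **`Typed.MissingUpperBoundAt W 3` ON A MONO-CARRIER (t′) ROW WITH A MANIN-CLEAN DATUM.** Data: `W/ℚ` globally minimal, non-CM,
additive of type (t′) at `3`, `E[3]` irreducible, `r_an(W) = 1`; a prime `q ∣ N_E` of ANY reduction type with
`ord₃ ∏_ℓ c_ℓ(E) ≤ ord₃ c_q(E)`; a datum `Dt` at level `N_E` with `3 ∤ c(Dt)`. DISPLAYED INPUTS: PUB (`hGZ hKo hGZK hmod hGZ73 hMN hnf
hFH`), crux 20165's reading S2′ (`h52I`), the named facts `h37 hPT hF1`, and `hL0` = the non-CM (t′) rank-ZERO lower half at `3`.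
Proof = p823764's `tprime_upper_three_of_irreducible_of_sigmaAtDatum_of_lowerRankZero` with Σ at `Dt` supplied by §1 (the Manin
unit makes the depth `ord₃ ∏ c_ℓ ≤ ord₃ c_q`). Supersedes `…MonoCarrier`'s §2 (p824349: multiplicative carrier, 27492 BY NAME).
CONDITIONAL; nothing asserted about any curve. [cite: Jetchev2008, Thm. 1.4 (p. 812)] [cite: MatarNekovar2019, Thm. 0.7 (p. 456), §0.11]
[cite: FriedbergHoffstein1995, Thm. B] [cite: GrossZagier1986, Thm. I.(6.3), (7.3)] [cite: Miller2011LMS, Def. 1.1] -/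
theorem tprime_upper_three_of_irreducible_carrier_of_prop52IrredP_of_namedFacts_of_lowerRankZero
    (hGZ : ∀ (N : ℕ) [NeZero N] (W : WeierstrassCurve ℚ) (K : Type) [Field K] [NumberField K],
      gross_zagier N W K)
    (hKo : ∀ (N : ℕ) [NeZero N] (W : WeierstrassCurve ℚ) (K : Type) [Field K] [NumberField K],
      kolyvagin N W K)
    (hGZK : rank_eq_analyticRank_of_analyticRank_le_one) (hmod : hasEntireLFunction_rat)
    (hGZ73 : GrossZagier1986_thm_I_7_3)
    (hMN : MatarNekovar2019.thm07_padicValNat_card_sha_primary_add_le_of_globalDivisibility_of_irreducible)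
    (hnf : exists_isNewformOf) (hFH : friedbergHoffstein_exists_heegnerField_splitDivisors_twist_ne_zero)
    (h52I : ∀ (W : WeierstrassCurve ℚ) [W.IsElliptic] [W.IsGloballyMinimal] [NeZero (W.conductorNorm ℤ)],
        ¬ W.HasCM →
        ∀ (K : Type) [Field K] [NumberField K], IsImaginaryQuadratic K →
        NumberField.discr K ≠ -3 → NumberField.discr K ≠ -4 →
        SatisfiesHeegnerHypothesis (W.conductorNorm ℤ) K →
        ∀ (p : ℕ) [Fact p.Prime], p ≠ 2 → W.HasIrreducibleModPGaloisRep p → (p : ℤ) ∣ W.conductorNorm ℤ →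
        ∀ (Dt : ModularParametrizationData W (W.conductorNorm ℤ)) (β : ℤ) (ι : K →+* ℂ)
          (d₁ : KolyvaginHeegnerData Dt β ι 1), ¬ IsOfFinAddOrder d₁.derivedPoint →
        ∀ (r : ℕ), 0 < r →
        ∀ (Mr : ℕ),
          IsLeast {u : ℕ | ∃ (n : ℕ) (d : KolyvaginHeegnerData Dt β ι n), Squarefree n ∧
              n.primeFactors.card = r ∧
              (∀ ℓ ∈ n.primeFactors, Zhang2014.IsKolyvaginPrime (W.conductorNorm ℤ) W K p ℓ ∧
                u + 1 ≤ Zhang2014.kolyvaginIndex W p ℓ) ∧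
              (∃ Q : (W.baseChange (ringClassField K ι n)).toAffine.Point,
                ((p ^ u : ℕ) : ℤ) • Q = d.derivedPoint) ∧
              ¬ ∃ Q : (W.baseChange (ringClassField K ι n)).toAffine.Point,
                ((p ^ (u + 1) : ℕ) : ℤ) • Q = d.derivedPoint} Mr →
        ∀ (M : ℕ), Mr < M →
          ∃ (n : ℕ) (d : KolyvaginHeegnerData Dt β ι n), Squarefree n ∧ n.primeFactors.card = r ∧
            (∀ ℓ ∈ n.primeFactors, Zhang2014.IsKolyvaginPrime (W.conductorNorm ℤ) W K p ℓ ∧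
              M ≤ Zhang2014.kolyvaginIndex W p ℓ) ∧
            addOrderOf (d.kolyvaginClass (Fact.out : p.Prime) M) = p ^ (M - Mr) ∧
            (∃ Q : (W.baseChange (ringClassField K ι n)).toAffine.Point,
              ((p ^ Mr : ℕ) : ℤ) • Q = d.derivedPoint) ∧
            ¬ ∃ Q : (W.baseChange (ringClassField K ι n)).toAffine.Point,
              ((p ^ (Mr + 1) : ℕ) : ℤ) • Q = d.derivedPoint)
    (h37 : GrossLMS1991.prop37_2_frobeniusCongruence)
    (hPT : ∀ (K : Type) [Field K] [NumberField K], poitouTate_selmerStructure_duality_conj K)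
    (hF1 : Gross1991_heegnerPoint_sub_ratTorsion_mem_E0_imageFree)
    (hL0 : ∀ (V : WeierstrassCurve ℚ) [V.IsElliptic] [V.IsGloballyMinimal],
      ¬ V.HasCM → Addv V 3 → SubTprime V 3 → V.analyticRank = 0 → MissingLowerBoundAt V 3)
    (W : WeierstrassCurve ℚ) [W.IsElliptic] [W.IsGloballyMinimal] [NeZero (W.conductorNorm ℤ)]
    (hCM : ¬ W.HasCM) (hadd : Addv W 3) (hT : SubTprime W 3) (hirr : W.HasIrreducibleModPGaloisRep 3)
    (hr : W.analyticRank = 1)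
    (q : ℕ) [Fact q.Prime] (hqN : q ∣ W.conductorNorm ℤ)
    (hmono : padicValNat 3 W.tamagawaProduct ≤ padicValNat 3 ((W.baseChange ℚ_[q]).localTamagawaNumber ℤ_[q]))
    (Dt : ModularParametrizationData W (W.conductorNorm ℤ)) (hc : ¬ (3 : ℤ) ∣ Dt.c) :
    MissingUpperBoundAt W 3 := by
  have h3N : 3 ∣ W.conductorNorm ℤ :=
    (W.dvd_conductorNorm_iff_not_hasGoodReductionAtPrime 3).mpr (not_good_of_addv W 3 hadd)
  have hc0 : padicValNat 3 Dt.c.natAbs = 0 :=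
    padicValNat.eq_zero_of_not_dvd fun h ↦ hc (Int.ofNat_dvd_left.mpr h)
  refine tprime_upper_three_of_irreducible_of_sigmaAtDatum_of_lowerRankZero hGZ hKo hGZK hmod hGZ73 hMN hnf hFH hL0
    W hCM hadd hT hirr hr Dt ?_
  intro K _ _ H ι P hK hHN _ hP hnt hodd s' hs' n d hn hℓ
  -- `d_K ∉ {-3, -4}`: `3 ∣ N_E` splits in `K`, `d_K` odd
  have h3 : NumberField.discr K ≠ -3 := by
    intro h
    exact (X11b.Three.not_dvd_discr_and_not_dvd_torsionOrder_of_heegner hK hHN (by decide) h3N).1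
      (h ▸ ⟨-1, by norm_num⟩)
  have h4 : NumberField.discr K ≠ -4 := by
    intro h
    rw [h] at hodd
    exact (Int.not_odd_iff_even.mpr ⟨-2, by norm_num⟩) hodd
  have hsq : s' ≤ padicValNat 3 ((W.baseChange ℚ_[q]).localTamagawaNumber ℤ_[q]) := by omega
  exact pDiv_of_dvd_level_of_heegnerFrame_of_prop52IrredP_of_namedFacts h52I h37 hPT hF1 W hCM K hK h3 h4 hHN 3 (by decide)
    hirr h3N Dt H ι P hP hnt q hqN s' hsq n d hn hℓ

/-! ## §4 In the binders of the registered irreducible-row stubs: ALL mono-carrier rows ⟸ PUB + S2′ + three named facts + KT 19981 -/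

/-- **The irreducible (t′) rank-one rows of `rows_of_manin_unit` ON ALL MONO-CARRIER ROWS from PUB + S2′ + three named facts + KT 19981,
by name.** For every non-CM (t′) rank-one `W` with `E[3]` irreducible such that (ROW) some prime `q ∣ N_E` — multiplicative or
additive — carries the whole `3`-part of `∏_ℓ c_ℓ(E)`, and every datum `D` at level `N_E` with `3 ∤ c(D)` (the Manin unit of
23736 / 23737): `Typed.MissingUpperBoundAt W 3` follows from the printed named facts, crux 20165's registered reading S2′ (`h52I`),
the three named Literature facts, and route KT's item `TameLowerHalfRankZero` (19981, BY NAME, read at `3` through p823764's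
`tprimeLowerRankZero_three_of_tameLowerHalfRankZero`). Supersedes `…MonoCarrier` §3 (p824349), which needed «`q ∥ N_E`», «every
Tamagawa-`3` carrier multiplicative» and RHP 27492. What Σ still owes on the irreducible rows: ONLY the rows with ≥ 2 Tamagawa-`3`
carriers. CONDITIONAL; closes nothing. [cite: Jetchev2008, Thm. 1.4 and Cor. 1.5 (p. 812), Conj. 1.3]
[cite: MatarNekovar2019, Thm. 0.7 (p. 456) and §0.11 (p. 457)] [cite: FriedbergHoffstein1995, Thm. B] [cite: Kato2004Asterisque, Thm. 17.4] -/
theorem irreducibleRows_monoCarrier_of_pub_of_prop52IrredP_of_namedFacts_of_tameLowerHalfRankZero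
    (hGZ : ∀ (N : ℕ) [NeZero N] (W : WeierstrassCurve ℚ) (K : Type) [Field K] [NumberField K],
      gross_zagier N W K)
    (hKo : ∀ (N : ℕ) [NeZero N] (W : WeierstrassCurve ℚ) (K : Type) [Field K] [NumberField K],
      kolyvagin N W K)
    (hGZK : rank_eq_analyticRank_of_analyticRank_le_one) (hGZ73 : GrossZagier1986_thm_I_7_3)
    (hMN : MatarNekovar2019.thm07_padicValNat_card_sha_primary_add_le_of_globalDivisibility_of_irreducible)
    (hnf : exists_isNewformOf) (hFH : friedbergHoffstein_exists_heegnerField_splitDivisors_twist_ne_zero)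
    (h52I : ∀ (W : WeierstrassCurve ℚ) [W.IsElliptic] [W.IsGloballyMinimal] [NeZero (W.conductorNorm ℤ)],
        ¬ W.HasCM →
        ∀ (K : Type) [Field K] [NumberField K], IsImaginaryQuadratic K →
        NumberField.discr K ≠ -3 → NumberField.discr K ≠ -4 →
        SatisfiesHeegnerHypothesis (W.conductorNorm ℤ) K →
        ∀ (p : ℕ) [Fact p.Prime], p ≠ 2 → W.HasIrreducibleModPGaloisRep p → (p : ℤ) ∣ W.conductorNorm ℤ →
        ∀ (Dt : ModularParametrizationData W (W.conductorNorm ℤ)) (β : ℤ) (ι : K →+* ℂ)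
          (d₁ : KolyvaginHeegnerData Dt β ι 1), ¬ IsOfFinAddOrder d₁.derivedPoint →
        ∀ (r : ℕ), 0 < r →
        ∀ (Mr : ℕ),
          IsLeast {u : ℕ | ∃ (n : ℕ) (d : KolyvaginHeegnerData Dt β ι n), Squarefree n ∧
              n.primeFactors.card = r ∧
              (∀ ℓ ∈ n.primeFactors, Zhang2014.IsKolyvaginPrime (W.conductorNorm ℤ) W K p ℓ ∧
                u + 1 ≤ Zhang2014.kolyvaginIndex W p ℓ) ∧
              (∃ Q : (W.baseChange (ringClassField K ι n)).toAffine.Point,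
                ((p ^ u : ℕ) : ℤ) • Q = d.derivedPoint) ∧
              ¬ ∃ Q : (W.baseChange (ringClassField K ι n)).toAffine.Point,
                ((p ^ (u + 1) : ℕ) : ℤ) • Q = d.derivedPoint} Mr →
        ∀ (M : ℕ), Mr < M →
          ∃ (n : ℕ) (d : KolyvaginHeegnerData Dt β ι n), Squarefree n ∧ n.primeFactors.card = r ∧
            (∀ ℓ ∈ n.primeFactors, Zhang2014.IsKolyvaginPrime (W.conductorNorm ℤ) W K p ℓ ∧
              M ≤ Zhang2014.kolyvaginIndex W p ℓ) ∧
            addOrderOf (d.kolyvaginClass (Fact.out : p.Prime) M) = p ^ (M - Mr) ∧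
            (∃ Q : (W.baseChange (ringClassField K ι n)).toAffine.Point,
              ((p ^ Mr : ℕ) : ℤ) • Q = d.derivedPoint) ∧
            ¬ ∃ Q : (W.baseChange (ringClassField K ι n)).toAffine.Point,
              ((p ^ (Mr + 1) : ℕ) : ℤ) • Q = d.derivedPoint)
    (h37 : GrossLMS1991.prop37_2_frobeniusCongruence)
    (hPT : ∀ (K : Type) [Field K] [NumberField K], poitouTate_selmerStructure_duality_conj K)
    (hF1 : Gross1991_heegnerPoint_sub_ratTorsion_mem_E0_imageFree)
    (hKT : KatoDescentTamePotSupersingular.TameLowerHalfRankZero) :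
    ∀ (W : WeierstrassCurve ℚ) [W.IsElliptic] [W.IsGloballyMinimal] [NeZero (W.conductorNorm ℤ)],
      ¬ W.HasCM → Rank1Residual.Addv W 3 → Summit.BirchSwinnertonDyer.Rank1Residual.Additive.SubTprime W 3 →
      W.HasIrreducibleModPGaloisRep 3 → W.analyticRank = 1 →
      (∃ (q : ℕ) (_ : Fact q.Prime), q ∣ W.conductorNorm ℤ ∧
        padicValNat 3 W.tamagawaProduct ≤ padicValNat 3 ((W.baseChange ℚ_[q]).localTamagawaNumber ℤ_[q])) →
      ∀ (D : ModularParametrizationData W (W.conductorNorm ℤ)), ¬ (3 : ℤ) ∣ D.maninConstant →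
        Rank1Residual.Typed.MissingUpperBoundAt W 3 := by
  intro W _ _ _ hCM hadd hT hirr hr hrow D hc
  obtain ⟨q, hq, hqN, hmono⟩ := hrow
  exact tprime_upper_three_of_irreducible_carrier_of_prop52IrredP_of_namedFacts_of_lowerRankZero hGZ hKo hGZK
    (hasEntireLFunction_rat_of_exists_isNewformOf hnf) hGZ73 hMN hnf hFH h52I h37 hPT hF1
    (tprimeLowerRankZero_three_of_tameLowerHalfRankZero hKT) W hCM hadd hT hirr hr q hqN hmono D hc

end Summit.BirchSwinnertonDyer.BirchSwinnertonDyer.Theorems.TprimeHeegnerUpperOfManinUnit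

end
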